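import Summits.ValiantsHypothesis.ValiantsHypothesis.Theorems.SymPencilPerFourCrossSixQuadratic
import Mathlib.LinearAlgebra.Matrix.ToLinearEquiv
import Mathlib.LinearAlgebra.FiniteDimensional.Lemmas

/-!
# Route `SymPencil` — the one-row endgame on the cross space: a split quadratic `6`-space admits
# no nilpotent skew map with isotropic image and isotropic kernel, and the flow-invariance /
# NC1 identities of the cross cell produce one (`--supports` stmt-ValiantsHypothesis-5674
# `SdcSuperquadratic`; size-`27` cell `(10,6,6)`, rung currency only, nothing here bears on
# `VP ≠ VNP`)

Abstract linear algebra over a field `k` of characteristic `0`, on `R = k^{2×3}` (the block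
«rows `1,2` × columns `1,2,3`» of a `4 × 4` matrix) with the quadratic form
`q_A(r) = r₁ᵀ A r₂` (`A` symmetric invertible `3 × 3`; polar form `β_A`), and on `X = k × R`
(the extra coordinate `ω` is the entry `(3,0)`).  This is the shape of the cubic
`per [a; ·]` on the space `{x₃' = 0}` met by the affine lever of the cross space
`V× = row 0 ⊕ k E₁₀ ⊕ k E₂₀` (`SymPencilAffineKernelLever`, `SymPencilPerFourCrossSixFront`):
`F(ω, r) = ω · q_A(r)` with `A = A(a') = [[0,a₃,a₂],[a₃,0,a₁],[a₂,a₁,0]]`.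

* `false_of_skew_isotropic` (the PARITY lemma): there is no linear `Y : R → R` with
  `β(r, Y r) = 0` (skew), `q(Y r) = 0` (isotropic image) and `q = 0` on `ker Y` (isotropic kernel).
  Proof: both `im Y` and `ker Y` are isotropic, hence of dimension `≤ 3`, so both have dimension
  `3` and `im Y = ker Y` (`Y² = 0` by skewness); then `(i, j) ↦ β(Y rᵢ, rⱼ)` on preimages of a
  basis of `im Y` is an antisymmetric `3 × 3` matrix, hence singular, and a kernel vector gives
  `r` with `Y r ≠ 0` and `β(Y r, ·) = 0` — contradicting non-degeneracy.
* `false_of_cross_endgame`: if a linear `K' : X → X` satisfies the FLOW INVARIANCE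
  `F(x + t K' x) = F(x)` (all `x, t`) and the NC1 identity `d · Θ(x)[K' x] = κ · F(x)` with
  `Θ(x)[y] = u(x)ᵀ C(y) u(x)` (`u` linear, `C` symmetric-valued linear, `d κ ≠ 0`), then `False`:
  the invariance forces `K'(ω, r) = (0, Y r)` with `Y` skew and of isotropic image (the Lie
  stabiliser of `ω · q(r)` is `k ⊕ co(q)`, and constancy along the straight line kills the
  scalar parts), and the `ω`-linear part of NC1 reads `κ q(r) = 2d · u(e)ᵀ C(0, Y r) u(0, r)`, so
  `q` vanishes on `ker Y`.

In the cell `(10,6,6)` these hypotheses are produced by the base-point pencil identity at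
`t · a` (`a ∈ row 0`) together with `det (D + t CL a) = det D` (algebraically closed field,
`SymPencilBasePointDetConst`).  No definitions (the forms are passed as functions with their
defining equations), no named facts. [folklore]
-/

noncomputable section

-- single-conjunct layout: Sub = Summit, duplicated namespace component intended
set_option linter.dupNamespace false

namespace Summit.ValiantsHypothesis.ValiantsHypothesis.Theorems.SymPencilPerFourCrossSixEndgame

open Matrix Module
open Summit.ValiantsHypothesis.ValiantsHypothesis.Theorems.SymPencilPerFourCrossSixQuadratic

universe u

variable {k : Type u} [Field k]

/-! ### The parity lemma -/

section Parity

variable [CharZero k] (A : Matrix (Fin 3) (Fin 3) k)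
  (q : (Fin 2 × Fin 3 → k) → k) (β : (Fin 2 × Fin 3 → k) → (Fin 2 × Fin 3 → k) → k)

/-- **The parity lemma.**  On the split quadratic `6`-space `(k^{2×3}, q_A)` there is no linear
`Y` with `β(r, Y r) = 0` for all `r` (skew), `q(Y r) = 0` for all `r` (isotropic image) and
`q = 0` on `ker Y`: image and kernel would be complementary-dimensional isotropic spaces, hence
`im Y = ker Y` Lagrangian, and `β(Y·, ·)` would be a non-degenerate ALTERNATING form on the
`3`-dimensional quotient. [folklore] -/
theorem false_of_skew_isotropic (hAs : Aᵀ = A) (hA : IsUnit A.det)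
    (hq : ∀ r : Fin 2 × Fin 3 → k, q r = ∑ i, ∑ j, r (0, i) * A i j * r (1, j))
    (hβ : ∀ r s : Fin 2 × Fin 3 → k,
      β r s = ∑ i, ∑ j, (r (0, i) * A i j * s (1, j) + s (0, i) * A i j * r (1, j)))
    (Y : (Fin 2 × Fin 3 → k) →ₗ[k] (Fin 2 × Fin 3 → k))
    (hskew : ∀ r, β r (Y r) = 0) (hiso : ∀ r, q (Y r) = 0) (hker : ∀ r, Y r = 0 → q r = 0) :
    False := by
  classical
  obtain ⟨B, hB⟩ := exists_bilinForm A q β hq hβ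
  have hcomm : ∀ r s, B r s = B s r := fun r s => by rw [hB, hB, β_comm A q β hq hβ]
  have hpolar : ∀ r s, B r s = q (r + s) - q r - q s := fun r s => by
    rw [hB, β_eq A q β hq hβ]
  have hnd : ∀ s, (∀ r, B r s = 0) → s = 0 := fun s hs =>
    eq_zero_of_β_eq_zero A β hAs hA hβ s fun r => by rw [← hB]; exact hs r
  -- polarised skewness and isotropy
  have hsk : ∀ r s, B r (Y s) = -B (Y r) s := by
    intro r s
    have h := hskew (r + s)
    rw [← hB, map_add, map_add, LinearMap.add_apply, map_add, map_add] at h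
    have h1 := hskew r
    have h2 := hskew s
    rw [← hB] at h1 h2
    rw [hcomm (Y r) s]
    linear_combination h - h1 - h2
  have hisoB : ∀ r s, B (Y r) (Y s) = 0 := by
    intro r s
    rw [hpolar, ← map_add, hiso, hiso, hiso]; ring
  have hY2 : ∀ s, Y (Y s) = 0 := fun s => hnd _ fun r => by rw [hsk, hisoB, neg_zero]
  have hRK : LinearMap.range Y ≤ LinearMap.ker Y := by
    rintro _ ⟨s, rfl⟩
    exact LinearMap.mem_ker.2 (hY2 s)
  -- dimensions: `im Y = ker Y`, both of dimension `3`
  have hK3 : finrank k (LinearMap.ker Y) ≤ 3 :=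
    finrank_le_three_of_isotropic A q β hAs hA hq hβ _ fun r hr => hker r (LinearMap.mem_ker.1 hr)
  have hR3 : finrank k (LinearMap.range Y) ≤ 3 :=
    finrank_le_three_of_isotropic A q β hAs hA hq hβ _ (by rintro _ ⟨s, rfl⟩; exact hiso s)
  have hsum := LinearMap.finrank_range_add_finrank_ker Y
  have h6 : finrank k (Fin 2 × Fin 3 → k) = 6 := by
    simp [Module.finrank_fintype_fun_eq_card]
  rw [h6] at hsum
  have hR : finrank k (LinearMap.range Y) = 3 := by omega
  have hKeq : LinearMap.range Y = LinearMap.ker Y :=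
    Submodule.eq_of_le_of_finrank_eq hRK (by omega)
  -- a basis of `im Y` and preimages
  let bY := Module.finBasisOfFinrankEq k (LinearMap.range Y) hR
  have hpre : ∀ i, ∃ r, Y r = (bY i : Fin 2 × Fin 3 → k) := fun i => by
    obtain ⟨r, hr⟩ := (bY i).2
    exact ⟨r, hr⟩
  choose rv hrv using hpre
  -- the antisymmetric `3 × 3` matrix `β (Y rvᵢ, rvⱼ)` is singular
  let M : Matrix (Fin 3) (Fin 3) k := Matrix.of fun i j => B (Y (rv i)) (rv j)
  have hMt : Mᵀ = -M := by
    ext i j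
    simp only [M, Matrix.transpose_apply, Matrix.of_apply, Matrix.neg_apply]
    rw [hcomm, hsk]
  have hdet : M.det = 0 := by
    have h := Matrix.det_transpose M
    rw [hMt, Matrix.det_neg, Fintype.card_fin] at h
    norm_num at h
    linear_combination (-1 / 2 : k) * h
  obtain ⟨c, hc0, hMc⟩ := Matrix.exists_mulVec_eq_zero_iff.2 hdet
  -- `r := Σ cᵢ rvᵢ` has `Y r ≠ 0` but `β (Y r, ·) = 0`
  set r : Fin 2 × Fin 3 → k := ∑ i, c i • rv i with hr
  have hYr : Y r = ∑ i, c i • (bY i : Fin 2 × Fin 3 → k) := by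
    simp only [hr, map_sum, map_smul, hrv]
  have hYr_ne : Y r ≠ 0 := by
    intro h0
    apply hc0
    have hli := bY.linearIndependent
    rw [Fintype.linearIndependent_iff] at hli
    refine funext fun i => hli c ?_ i
    apply Subtype.ext
    rw [Submodule.coe_sum, Submodule.coe_zero, ← h0, hYr]
    simp
  have hrow : ∀ j, B (Y r) (rv j) = 0 := by
    intro j
    have hj := congr_fun hMc j
    rw [Pi.zero_apply, Matrix.mulVec, dotProduct] at hj
    have hexp : B (Y r) (rv j) = ∑ i, c i * M i j := by
      rw [hr, map_sum, map_sum, LinearMap.sum_apply]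
      refine Finset.sum_congr rfl fun i _ => ?_
      rw [map_smul, map_smul, LinearMap.smul_apply, smul_eq_mul]
      simp only [M, Matrix.of_apply]
    have hanti : ∀ i, M i j = -M j i := fun i => by
      have := congr_fun (congr_fun hMt j) i
      simpa [Matrix.transpose_apply] using this
    rw [hexp]
    calc ∑ i, c i * M i j = -∑ i, M j i * c i := by
          rw [← Finset.sum_neg_distrib]
          exact Finset.sum_congr rfl fun i _ => by rw [hanti]; ring
      _ = 0 := by rw [hj, neg_zero]
  have horth : ∀ s, B (Y r) s = 0 := by
    intro s
    have hYs : Y s ∈ LinearMap.range Y := ⟨s, rfl⟩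
    set s₀ : Fin 2 × Fin 3 → k := ∑ i, (bY.repr ⟨Y s, hYs⟩ i) • rv i with hs₀
    have hYs₀ : Y s₀ = Y s := by
      have h := bY.sum_repr ⟨Y s, hYs⟩
      have h' := congr_arg Subtype.val h
      rw [Submodule.coe_sum] at h'
      simp only [Submodule.coe_smul] at h'
      rw [hs₀, map_sum]
      simp only [map_smul, hrv]
      exact h'
    have hdiff : s - s₀ ∈ LinearMap.ker Y := by
      rw [LinearMap.mem_ker, map_sub, hYs₀, sub_self]
    rw [← hKeq] at hdiff
    obtain ⟨w, hw⟩ := hdiff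
    have hs : s = s₀ + Y w := by rw [hw]; abel
    rw [hs, map_add, hisoB, add_zero, hs₀, map_sum]
    refine Finset.sum_eq_zero fun i _ => ?_
    rw [map_smul, hrow, smul_zero]
  exact hYr_ne (hnd _ fun s => by rw [hcomm]; exact horth s)

end Parity


/-! ### The cross endgame -/

section Endgame

variable [CharZero k] (A : Matrix (Fin 3) (Fin 3) k)
  (q : (Fin 2 × Fin 3 → k) → k) (β : (Fin 2 × Fin 3 → k) → (Fin 2 × Fin 3 → k) → k)

/-- **The cross endgame.**  On `X = k × k^{2×3}` with the cubic `F(ω, r) = ω · q_A(r)` (`A`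
symmetric invertible), no linear `K' : X → X` satisfies the flow invariance
`F(x + t K' x) = F(x)` for all `x, t` together with an NC1-type identity
`d · Θ(x)[K' x] = κ · F(x)` whose left side is linear in `K' x` (here
`Θ(x)[y] = u(x)ᵀ C(y) u(x)` with `C` linear), `d, κ ≠ 0`.  Indeed the invariance forces
`K'(ω, r) = (0, Y r)` with `Y` skew for `β_A` and of `q_A`-isotropic image, and the identity at
`x = (1, r)` with `Y r = 0` gives `q_A(r) = 0` on `ker Y`; contradiction by
`false_of_skew_isotropic`. [folklore] -/
theorem false_of_cross_endgame (hAs : Aᵀ = A) (hA : IsUnit A.det)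
    (hq : ∀ r : Fin 2 × Fin 3 → k, q r = ∑ i, ∑ j, r (0, i) * A i j * r (1, j))
    (hβ : ∀ r s : Fin 2 × Fin 3 → k,
      β r s = ∑ i, ∑ j, (r (0, i) * A i j * s (1, j) + s (0, i) * A i j * r (1, j)))
    (K' : (k × (Fin 2 × Fin 3 → k)) →ₗ[k] (k × (Fin 2 × Fin 3 → k)))
    {ι' : Type*} (u : (k × (Fin 2 × Fin 3 → k)) → (ι' → k)) [Fintype ι']
    (Cm : (k × (Fin 2 × Fin 3 → k)) →ₗ[k] Matrix ι' ι' k) {d κ : k} (hκ : κ ≠ 0)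
    (hflow : ∀ (x : k × (Fin 2 × Fin 3 → k)) (t : k),
      (x + t • K' x).1 * q (x + t • K' x).2 = x.1 * q x.2)
    (hNC : ∀ x : k × (Fin 2 × Fin 3 → k), d * (u x ⬝ᵥ Cm (K' x) *ᵥ u x) = κ * (x.1 * q x.2)) :
    False := by
  -- the three coefficient identities of the flow invariance
  have hco : ∀ x : k × (Fin 2 × Fin 3 → k),
      (K' x).1 * q x.2 + x.1 * β x.2 (K' x).2 = 0 ∧
      (K' x).1 * β x.2 (K' x).2 + x.1 * q (K' x).2 = 0 ∧ (K' x).1 * q (K' x).2 = 0 := by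
    intro x
    refine cubic_coeffs_eq_zero fun t => ?_
    have h := hflow x t
    rw [Prod.fst_add, Prod.snd_add, Prod.smul_fst, Prod.smul_snd, smul_eq_mul,
      q_add_smul A q β hq hβ] at h
    linear_combination h
  -- `φ = 0`: the `ω`-component of `K'(0, r)` vanishes
  let φ : (Fin 2 × Fin 3 → k) →ₗ[k] k :=
    LinearMap.fst k k (Fin 2 × Fin 3 → k) ∘ₗ K' ∘ₗ LinearMap.inr k k (Fin 2 × Fin 3 → k)
  have hφ : ∀ r, φ r = (K' (0, r)).1 := fun r => rfl
  have hφ0 : φ = 0 := linear_eq_zero_of_mul_q A q β hA hq hβ φ fun r => by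
    have h := (hco ((0 : k), r)).1
    rw [zero_mul, add_zero] at h
    rw [hφ]; exact h
  have hK1 : ∀ r, (K' ((0 : k), r)).1 = 0 := fun r => by
    rw [← hφ, hφ0, LinearMap.zero_apply]
  -- `K'(ω, r) = ω K'(1,0) + K'(0,r) =: (ω α, ω ψ + Y r)`
  have hdec : ∀ (ω : k) (r : Fin 2 × Fin 3 → k),
      K' (ω, r) = ω • K' (1, 0) + K' (0, r) := by
    intro ω r
    have : ((ω, r) : k × (Fin 2 × Fin 3 → k)) =
        ω • ((1 : k), (0 : Fin 2 × Fin 3 → k)) + ((0 : k), r) := by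
      ext <;> simp
    rw [this, map_add, map_smul]
  set α : k := (K' ((1 : k), (0 : Fin 2 × Fin 3 → k))).1 with hαdef
  set ψ : Fin 2 × Fin 3 → k := (K' ((1 : k), (0 : Fin 2 × Fin 3 → k))).2 with hψdef
  let Y : (Fin 2 × Fin 3 → k) →ₗ[k] (Fin 2 × Fin 3 → k) :=
    LinearMap.snd k k (Fin 2 × Fin 3 → k) ∘ₗ K' ∘ₗ LinearMap.inr k k (Fin 2 × Fin 3 → k)
  have hY : ∀ r, Y r = (K' (0, r)).2 := fun r => rfl
  have hK'1 : ∀ (ω : k) (r : Fin 2 × Fin 3 → k), (K' (ω, r)).1 = ω * α := by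
    intro ω r
    rw [hdec, Prod.fst_add, Prod.smul_fst, hK1, add_zero, smul_eq_mul]
  have hK'2 : ∀ (ω : k) (r : Fin 2 × Fin 3 → k), (K' (ω, r)).2 = Y r + ω • ψ := by
    intro ω r
    rw [hdec, Prod.snd_add, Prod.smul_snd, hY, add_comm]
  -- `ψ = 0`
  have hc1 : ∀ (ω : k) (r : Fin 2 × Fin 3 → k),
      ω * α * q r + ω * (β r (Y r) + ω * β r ψ) = 0 := by
    intro ω r
    have h := (hco (ω, r)).1
    rw [hK'1, hK'2, β_add_smul_right A β hβ] at h
    exact h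
  have hψβ : ∀ r, β r ψ = 0 := by
    intro r
    have h1 := hc1 1 r
    have h2 := hc1 (-1) r
    linear_combination (1 / 2 : k) * h1 + (1 / 2 : k) * h2
  have hψ : ψ = 0 := eq_zero_of_β_eq_zero A β hAs hA hβ ψ hψβ
  -- `α = 0`
  have hE1 : ∀ r, α * q r + β r (Y r) = 0 := by
    intro r
    have h := hc1 1 r
    rw [hψβ] at h
    linear_combination h
  have hc2 : ∀ r, α * β r (Y r) + q (Y r) = 0 := by
    intro r
    have h := (hco ((1 : k), r)).2.1
    rw [hK'1, hK'2, hψ, smul_zero, add_zero, one_mul, one_mul] at h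
    exact h
  have hc3 : ∀ r, α * q (Y r) = 0 := by
    intro r
    have h := (hco ((1 : k), r)).2.2
    rw [hK'1, hK'2, hψ, smul_zero, add_zero, one_mul] at h
    exact h
  obtain ⟨r₁, hr₁⟩ := exists_q_ne_zero A q hA hq
  have hα : α = 0 := by
    have e1 := hE1 r₁
    have e2 := hc2 r₁
    have e3 := hc3 r₁
    have h3 : α ^ 3 * q r₁ = 0 := by linear_combination e3 - α * e2 + α ^ 2 * e1
    exact (pow_eq_zero_iff three_ne_zero).1 ((mul_eq_zero.1 h3).resolve_right hr₁)
  have hskew : ∀ r, β r (Y r) = 0 := fun r => by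
    have h := hE1 r
    rwa [hα, zero_mul, zero_add] at h
  have hiso : ∀ r, q (Y r) = 0 := fun r => by
    have h := hc2 r
    rwa [hα, zero_mul, zero_add] at h
  -- `K'(ω, r) = (0, Y r)`; NC1 at `(1, r)` with `Y r = 0` gives `q r = 0`
  have hker : ∀ r, Y r = 0 → q r = 0 := by
    intro r hr0
    have h := hNC ((1 : k), r)
    have hK0 : K' ((1 : k), r) = 0 := by
      ext
      · rw [hK'1, hα, mul_zero, Prod.fst_zero]
      · rw [hK'2, hψ, smul_zero, add_zero, hr0, Prod.snd_zero]
    rw [hK0, map_zero, Matrix.zero_mulVec, dotProduct_zero, mul_zero, one_mul] at h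
    exact (mul_eq_zero.1 h.symm).resolve_left hκ
  exact false_of_skew_isotropic A q β hAs hA hq hβ Y hskew hiso hker

end Endgame

end Summit.ValiantsHypothesis.ValiantsHypothesis.Theorems.SymPencilPerFourCrossSixEndgame

end
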